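import Literature.NumberTheory.GaloisRepresentations.ContinuousCorestrictionComp
import HarnessLib

/-!
# `res ∘ cor` is the norm `Σ_{x ∈ U/N} s(x)·(−)` on continuous `H¹(N, X)` for a NORMAL subgroup `N`
# (the normal case of the double-coset formula), complement to `ContinuousCorestriction.lean`

For `N ⊴ G` open and of finite index in a subgroup `U ≥ N` of a topological group `G`, a topological
representation `X` of `G`, and any system `s` of representatives of `U/N`:
`res_{U→N} ∘ cor_{N→U} = Σ_{x ∈ U/N} conj_{s(x)}` on `H¹(N, X)` (`resLe_coresLe_eq_sum_conjMap`).
On cocycles this is an EQUALITY: `(cor_s φ)(n) = Σ_x s(x)·φ(s(x)⁻¹ n s(x))` for `n ∈ N`, because `n`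
acts trivially on `U/N` when `N` is normal (so the Schreier element at `(n, x)` is `s(x)⁻¹ n s(x)`), and
`(s(x)·φ)(n) = s(x)·φ(s(x)⁻¹ n s(x))` is the tree's `conjMap` (`conj_pullback_apply`).
Seat `bsd-potss-rkm` (cell `bsd-potss`, item stmt-BirchSwinnertonDyer-19196): plumbing toward W2 of the
zeta-class pin (integrality of corestricted Euler-system classes: with `N = Gal(ℚ̄/ℚ(μ_{p^{n+1}}))`
normal in `Γ_ℚ` and the inertia groups at `v ≠ p` inside `N`, `res_{I_𝔓} ∘ cor` becomes a sum of
conjugates of restrictions of the original class to inertia groups at conjugate primes).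
No new objects, no named facts.

References: J. Neukirch, A. Schmidt, K. Wingberg, *Cohomology of Number Fields*, 2nd ed. (2008), I §5
(1.5.6)–(1.5.7) (cor on cochains; the double coset formula `res ∘ cor`) [NeukirchSchmidtWingberg2008];
J.-P. Serre, *Local Fields* (1979), VII §5–§7 [SerreLocalFields1979].
-/

noncomputable section

open CategoryTheory

universe u v

namespace Literature.NumberTheory.GaloisRepresentations

open Literature.NumberTheory.EllipticCurves (schreierElt schreierElt_mem schreierElt_coe
  rep_mul_schreierElt schreierElt_mul rep_inv_mul_rep_mem subgroupInclusion
  subgroupInclusion_apply_coe subgroupConj subgroupConj_apply_coe)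

variable {R : Type u} [Ring R] [TopologicalSpace R]
variable {G : Type v} [Group G] [TopologicalSpace G] [IsTopologicalGroup G]
variable (X : TopRep.{v} R G) {N U : Subgroup G}

omit [TopologicalSpace G] [IsTopologicalGroup G] in
/-- For `N` normal, elements of `N` act trivially on `U/N`. [folklore] -/
private theorem smul_eq_self_of_mem [N.Normal] {n : U} (hn : (n : G) ∈ N)
    (x : U ⧸ N.subgroupOf U) : n • x = x := by
  induction x using QuotientGroup.induction_on with
  | H u =>
    rw [MulAction.Quotient.smul_mk, QuotientGroup.eq, Subgroup.mem_subgroupOf, smul_eq_mul]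
    have : (((n * u)⁻¹ * u : U) : G) = (u : G)⁻¹ * (n : G)⁻¹ * ((u : G)⁻¹)⁻¹ := by
      push_cast; group
    rw [this]
    exact Subgroup.Normal.conj_mem inferInstance _ (N.inv_mem hn) _

/-- **`res ∘ cor` for a NORMAL subgroup is the norm**: for `N ⊴ G` open of finite index in `U ≥ N`
and any system `s` of representatives of `U/N`,
`res_{U→N} (cor_{N→U} ξ) = Σ_{x ∈ U/N} s(x) · ξ` on `H¹(N, X)` (Neukirch–Schmidt–Wingberg (1.5.7)
double-coset formula in the normal case: on cocycles `(cor φ)(n) = Σ_x s(x)·φ(s(x)⁻¹ n s(x))` since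
`n ∈ N` acts trivially on `U/N`). [cite: NeukirchSchmidtWingberg2008, I §5 (1.5.6)–(1.5.7)] -/
theorem resLe_coresLe_eq_sum_conjMap [N.Normal] (h : N ≤ U) (hN : IsOpen (N : Set G))
    [Fintype (U ⧸ N.subgroupOf U)] {s : U ⧸ N.subgroupOf U → U}
    (hs : ∀ x, (s x : U ⧸ N.subgroupOf U) = x) (ξ : continuousCohomology 1 (subgroupRep X N)) :
    resLe X h 1 (coresLe X h hN ξ) = ∑ x, conjMap X N (s x : G) 1 ξ := by
  obtain ⟨φ, rfl⟩ := oneCocycleClass_surjective _ ξ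
  rw [coresLe_oneCocycleClass X h hN hs φ, resLe_oneCocycleClass]
  simp_rw [conjMap_oneCocycleClass, ← oneCocycleClassₗ_apply, ← map_sum]
  rw [oneCocycleClassₗ_apply, oneCocycleClassₗ_apply]
  congr 1
  apply Subtype.ext
  ext n
  rw [contOneCocycles.pullback_apply, TopRep.hom_ofHom, sum_apply_val']
  change (transferCocycle (subgroupRep X U) (N.subgroupOf U) (isOpen_subgroupOf U hN) hs
      (contOneCocycles.pullback (subgroupOfHom h)
        (Y := subgroupRep (subgroupRep X U) (N.subgroupOf U))
        (TopRep.ofHom ⟨ContinuousLinearMap.id R X, fun _ => rfl⟩) φ)).1 (subgroupInclusion h n) = _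
  rw [transferCocycle_pullback_apply X h hN hs]
  refine Finset.sum_congr rfl fun x _ ↦ ?_
  have hnx : subgroupInclusion h n • x = x := smul_eq_self_of_mem (by simp [n.2]) x
  rw [conj_pullback_apply, hnx]
  congr 2
  apply Subtype.ext
  rw [subgroupOfHom_apply_coe, schreierElt_coe, subgroupConj_apply_coe, hnx]
  simp [subgroupInclusion_apply_coe]

end Literature.NumberTheory.GaloisRepresentations

end
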